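import Summits.QuantumFields.BalabanUV.T4Continuum.Support.NE7MovingCurlGradient
import HarnessLib

/-!
# NE7CurlRemainderGradient — socket `h′` SUPPLIER LINE, stub (S-b)₂ brick 3 (ROAD-G106 §6 «THE CLAIM»): THE SECOND-ORDER REMAINDER OF THE REVERSE
# CURL READING IS LIPSCHITZ — for `U′ = W·e^{X}` and `E₂(p) := U′(∂p) − W(∂p) − (d_W X)(p)·W(∂p)`, the transported adjacent difference
# `‖Ad_{W(z,λ)} E₂(p′) − E₂(p)‖` is at most `R = Q + 24α(e^α − 1)·G + ‖∇c‖·(4α + 24α(e^α − 1)) + 4α(G + x₁)`, where `Q` bounds the motion of the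
# transported adjacent difference of the dressed curl along the segment (`NE7MovingCurlGradient`), `G` the `W`-transported plaquette-gradient radius along
# the segment (`NE7SegmentPlaquetteGradient` + §2), `x₁` the plaquette-gradient radius of `W` at `(p, λ)`, `∇c = Ad_{W(z,λ)} (d_W X)(p′) − (d_W X)(p)`;
# WHENCE THE RAW ABSORBED READING `‖∇c‖ ≤ ‖∇D‖ + R + (8α + 24α(e^α − 1))·x₁` (`D = U′(∂p)·W(∂p)⁻¹ − 1`, (S-b)₁)

Cell `pub-balaban`, rung (B)+1 sub-cell t4, lineage `b2b-balaban-t4-ne7-p1`, generation 107 (CRUX PROVER NE7 #1 = OWNER of BINDER row NE7).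
Memo `t4/b2b-balaban-t4-ne7-p1-g106/ROAD-G106.md` §4 (S-b), §6; sequel memo `…-g107/ROAD-G107.md` §1.
WHY.  (S-b) of the supplier line = the datum `B′` (one lattice derivative on the dressed curl of the relative coordinate `X` of the minimiser pair) for
the C¹ slice letter (S-d).  The reverse curl reading (`NE3CurlReverseReading.norm_curlAt_le_of_vary`) is `(d_W X)(p)·W(∂p) = U′(∂p) − W(∂p) − E₂(p)` with
`‖E₂‖ = O(α²)`; (S-b)₁ (`NE7PlaquetteQuotientGradient`, gen 106) bounds the transported adjacent difference of the QUOTIENT `D`; THIS FILE bounds that of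
the REMAINDER `E₂` — by a first-order mean value inequality for the path
`F(t) = Ad_{W(z,λ)} (V_t(∂p′) − t·c′·W(∂p′)) − (V_t(∂p) − t·c·W(∂p))` (`V_t = W e^{tX}`, `F(1) − F(0) = ∇E₂`), whose derivative
`Ad_W (c′_t·V_t(∂p′) − c′·W(∂p′)) − (c_t·V_t(∂p) − c·W(∂p))` splits by the product rule for transported differences (§1) into terms each carrying one of
the small letters — and then ABSORBS: `c = D − E₂·W(∂p)⁻¹`, so `‖∇c‖ ≤ ‖∇D‖ + ‖∇E₂‖ + ‖E₂‖·x₁` with `‖∇E₂‖ ≤ R ∋ O(α)·‖∇c‖` (§5; the explicit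
letters and the polynomial form are the next file's, `NE7CurlGradientReading`).
WHAT ([folklore]; 0 def, 0 sorry; any dimension, any `U(n)`; `W` unitary, `X` skew, `‖X‖ ≤ α`; `w = W(z,λ)`, `p = (z; μ, ν)`, `p′ = p + e_λ`):
 * §1 `Ad_mul_sub_mul`, `norm_Ad_mul_sub_mul_le` (product rule for transported adjacent differences); `norm_Ad_sub_Ad_le_near_one`.
 * §2 `norm_transPlaqW_le` — `‖Ad_w V_s(∂p′) − V_s(∂p)‖ ≤ ‖Ad_{V_s(z,λ)} V_s(∂p′) − V_s(∂p)‖ + 2(e^α − 1)·x′` (`x′ ≥ ‖V_s(∂p′) − 1‖`).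
 * §3 `hasDerivAt_remainderPath`; §4 **`norm_remainderPath_deriv_le`** (`≤ R` on `[0,1]` given `Q`, `G`, `x₁`).
 * §5 **`norm_remainder_covDiff_le`** (`‖Ad_w E₂(p′) − E₂(p)‖ ≤ R`); `norm_Ad_inv_sub_inv_le`, `norm_remainder_le` (`‖E₂‖ ≤ 8α + 24α(e^α − 1)`);
   **`norm_curl_covDiff_le_abstract`** — `‖∇c‖ ≤ ‖Ad_w D(p′) − D(p)‖ + R + (8α + 24α(e^α − 1))·x₁`.
HONEST FRAMING (page 1): lattice kinematics on OUR objects; `Q`, `G`, `x₁` are HYPOTHESES here (discharged from the letters `α, α₁, x` in the next file);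
nothing of Bałaban's asserted as an axiom; nothing of NE3∕NE7 discharged; spine count = dagwriter∕referees' call; FIXED FINITE T⁴, rung (B)+1 — NOT infinite
volume, NOT mass gap, NOT BetaPertH, NOT Clay.
-/

set_option autoImplicit false

open scoped BigOperators Matrix Matrix.Norms.L2Operator
open Finset NormedSpace Set

namespace Summit.QuantumFields.BalabanUV.T4Continuum.NE7CurlRemainderGradient

open Literature.MathematicalPhysics.QuantumFieldTheory.Balaban1983to89
open B7Prop1Explicit B7Prop2Explicit
open T4AveragingDeficitWall hiding Site Plane Plaq Bond
open T4AveragingDeficitNonAbelian (Ad_mul Ad_sub U1_of_unitaryUnits)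
open AveragingDeficitTransport (norm_Ad_of_unitary)
open AveragingDeficitNearIdentity (Ad_add)
open AveragingDeficitPlaqDeriv (vary_isUnitaryCfg)
open NE3HessContinuity (bondL1At bondL1At_nonneg)
open NE3CurlStability (norm_Ad_sub_Ad_le norm_vary_sub_le_of_sup norm_curlAt_vary_sub_le)
open NE3EnergySmallFieldCurl (hasDerivAt_hol_vary_at norm_hol_vary_sub_hol_le_curl)
open NE7CubicVertexLetters (bondL1At_le_of_sup)
open NE7ExpansionRemainderCurvedWeak (norm_curlAt_le_bondL1At)
open NE7PlaquetteQuotientGradient (Ad_mul_right Ad_inv_sub_inv_eq)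
open SkeletonPrecompTools (Ad_apply_one)
open NE7MovingCurlGradient (hasDerivAt_Ad_comp)

noncomputable section

variable {d : ℕ} {n : Type*} [Fintype n] [DecidableEq n]

/-! ## §1 The product rule for transported adjacent differences -/

/-- `Ad_w(P′Q′) − PQ = (Ad_w P′ − P)·Ad_w Q′ + P·(Ad_w Q′ − Q)`. [folklore] -/
theorem Ad_mul_sub_mul (w : (Matrix n n ℂ)ˣ) (P' Q' P Q : Matrix n n ℂ) :
    Ad w (P' * Q') - P * Q = (Ad w P' - P) * Ad w Q' + P * (Ad w Q' - Q) := by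
  rw [Ad_mul_right]; noncomm_ring

/-- `‖Ad_w(P′Q′) − PQ‖ ≤ ‖Ad_w P′ − P‖·‖Ad_w Q′‖ + ‖P‖·‖Ad_w Q′ − Q‖`. [folklore] -/
theorem norm_Ad_mul_sub_mul_le (w : (Matrix n n ℂ)ˣ) (P' Q' P Q : Matrix n n ℂ) :
    ‖Ad w (P' * Q') - P * Q‖ ≤ ‖Ad w P' - P‖ * ‖Ad w Q'‖ + ‖P‖ * ‖Ad w Q' - Q‖ := by
  rw [Ad_mul_sub_mul]
  exact (norm_add_le _ _).trans (add_le_add (norm_mul_le _ _) (norm_mul_le _ _))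

/-- Near-identity form of `NE3CurlStability.norm_Ad_sub_Ad_le`: `‖Ad_{u′}Y − Ad_u Y‖ ≤ 2‖u′ − u‖·‖Y − 1‖` for unitary `u, u′`. [folklore] -/
theorem norm_Ad_sub_Ad_le_near_one [Nonempty n] {u u' : (Matrix n n ℂ)ˣ} (hu : u ∈ unitaryUnits (Matrix n n ℂ))
    (hu' : u' ∈ unitaryUnits (Matrix n n ℂ)) (Y : Matrix n n ℂ) :
    ‖Ad u' Y - Ad u Y‖ ≤ 2 * ‖(u' : Matrix n n ℂ) - (u : Matrix n n ℂ)‖ * ‖Y - 1‖ := by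
  have e1 : Ad u' Y - Ad u Y = Ad u' (Y - 1) - Ad u (Y - 1) := by
    rw [Ad_sub, Ad_sub, Ad_apply_one, Ad_apply_one]; abel
  rw [e1]; exact norm_Ad_sub_Ad_le hu hu' (Y - 1)

/-! ## §2 The `W`-transported plaquette-gradient radius along the segment against the `V_s`-transported one -/

/-- **`‖Ad_{W(z,λ)} V_s(∂p′) − V_s(∂p)‖ ≤ ‖Ad_{V_s(z,λ)} V_s(∂p′) − V_s(∂p)‖ + 2(e^α − 1)·x′`** for `s ∈ [0,1]`, `x′ ≥ ‖V_s(∂p′) − 1‖`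
(`‖V_s(z,λ) − W(z,λ)‖ ≤ e^{sα} − 1`, near-identity transport change). [folklore] -/
theorem norm_transPlaqW_le [Nonempty n] {W : Site d → Fin d → (Matrix n n ℂ)ˣ} (hW : IsUnitaryCfg W)
    {X : Site d → Fin d → Matrix n n ℂ} (hX : IsSkewDir X) {α : ℝ} (hXα : ∀ x κ, ‖X x κ‖ ≤ α) (z : Site d) (lam μ ν : Fin d)
    {s : ℝ} (hs : s ∈ Icc (0 : ℝ) 1) {x' : ℝ}
    (hx' : ‖((hol (vary W X s) (z + e lam) (plaqWord μ ν) : (Matrix n n ℂ)ˣ) : Matrix n n ℂ) - 1‖ ≤ x') :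
    ‖Ad (W z lam) ((hol (vary W X s) (z + e lam) (plaqWord μ ν) : (Matrix n n ℂ)ˣ) : Matrix n n ℂ)
        - ((hol (vary W X s) z (plaqWord μ ν) : (Matrix n n ℂ)ˣ) : Matrix n n ℂ)‖
      ≤ ‖Ad (vary W X s z lam) ((hol (vary W X s) (z + e lam) (plaqWord μ ν) : (Matrix n n ℂ)ˣ) : Matrix n n ℂ)
          - ((hol (vary W X s) z (plaqWord μ ν) : (Matrix n n ℂ)ˣ) : Matrix n n ℂ)‖ + 2 * (Real.exp α - 1) * x' := by
  set Y := ((hol (vary W X s) (z + e lam) (plaqWord μ ν) : (Matrix n n ℂ)ˣ) : Matrix n n ℂ) with hY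
  set Z := ((hol (vary W X s) z (plaqWord μ ν) : (Matrix n n ℂ)ˣ) : Matrix n n ℂ) with hZ
  have hα0 : 0 ≤ α := (norm_nonneg _).trans (hXα z lam)
  have hx'0 : 0 ≤ x' := (norm_nonneg _).trans hx'
  have h1 := norm_Ad_sub_Ad_le_near_one (vary_isUnitaryCfg hW hX s z lam) (hW z lam) Y
  have h2 : ‖((W z lam : (Matrix n n ℂ)ˣ) : Matrix n n ℂ) - (vary W X s z lam : Matrix n n ℂ)‖ ≤ Real.exp α - 1 := by
    rw [norm_sub_rev]
    refine (norm_vary_sub_le_of_sup hW hXα s z lam).trans ?_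
    rw [abs_of_nonneg hs.1]
    have := Real.exp_le_exp.mpr (show s * α ≤ α by nlinarith [hs.2])
    linarith
  have hexp0 : 0 ≤ Real.exp α - 1 := by linarith [Real.add_one_le_exp α]
  have h3 : ‖Ad (W z lam) Y - Ad (vary W X s z lam) Y‖ ≤ 2 * (Real.exp α - 1) * x' :=
    h1.trans (mul_le_mul (mul_le_mul_of_nonneg_left h2 (by norm_num)) hx' (norm_nonneg _) (by positivity))
  calc ‖Ad (W z lam) Y - Z‖ = ‖(Ad (vary W X s z lam) Y - Z) + (Ad (W z lam) Y - Ad (vary W X s z lam) Y)‖ := by congr 1; abel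
    _ ≤ ‖Ad (vary W X s z lam) Y - Z‖ + ‖Ad (W z lam) Y - Ad (vary W X s z lam) Y‖ := norm_add_le _ _
    _ ≤ ‖Ad (vary W X s z lam) Y - Z‖ + 2 * (Real.exp α - 1) * x' := by linarith

/-! ## §3 The remainder path and its derivative -/

/-- **THE REMAINDER PATH** `F(t) = Ad_{W(z,λ)} (V_t(∂p′) − t·c′·W(∂p′)) − (V_t(∂p) − t·c·W(∂p))` has derivative
`Ad_{W(z,λ)} ((d_{V_t}X)(p′)·V_t(∂p′) − c′·W(∂p′)) − ((d_{V_t}X)(p)·V_t(∂p) − c·W(∂p))` (`c = (d_W X)(p)`, `c′ = (d_W X)(p′)`). [folklore] -/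
theorem hasDerivAt_remainderPath (W : Site d → Fin d → (Matrix n n ℂ)ˣ) (X : Site d → Fin d → Matrix n n ℂ) (z : Site d) (lam μ ν : Fin d) (t : ℝ) :
    HasDerivAt (fun r : ℝ =>
        Ad (W z lam) (((hol (vary W X r) (z + e lam) (plaqWord μ ν) : (Matrix n n ℂ)ˣ) : Matrix n n ℂ)
            - r • (curlAt W X (z + e lam) μ ν * ((hol W (z + e lam) (plaqWord μ ν) : (Matrix n n ℂ)ˣ) : Matrix n n ℂ)))
          - (((hol (vary W X r) z (plaqWord μ ν) : (Matrix n n ℂ)ˣ) : Matrix n n ℂ)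
            - r • (curlAt W X z μ ν * ((hol W z (plaqWord μ ν) : (Matrix n n ℂ)ˣ) : Matrix n n ℂ))))
      (Ad (W z lam) (curlAt (vary W X t) X (z + e lam) μ ν * ((hol (vary W X t) (z + e lam) (plaqWord μ ν) : (Matrix n n ℂ)ˣ) : Matrix n n ℂ)
            - curlAt W X (z + e lam) μ ν * ((hol W (z + e lam) (plaqWord μ ν) : (Matrix n n ℂ)ˣ) : Matrix n n ℂ))
          - (curlAt (vary W X t) X z μ ν * ((hol (vary W X t) z (plaqWord μ ν) : (Matrix n n ℂ)ˣ) : Matrix n n ℂ)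
            - curlAt W X z μ ν * ((hol W z (plaqWord μ ν) : (Matrix n n ℂ)ˣ) : Matrix n n ℂ))) t := by
  have hP := hasDerivAt_hol_vary_at W X (z + e lam) μ ν t
  have hZ := hasDerivAt_hol_vary_at W X z μ ν t
  have hP2 : HasDerivAt (fun r : ℝ => r • (curlAt W X (z + e lam) μ ν * ((hol W (z + e lam) (plaqWord μ ν) : (Matrix n n ℂ)ˣ) : Matrix n n ℂ)))
      ((1 : ℝ) • (curlAt W X (z + e lam) μ ν * ((hol W (z + e lam) (plaqWord μ ν) : (Matrix n n ℂ)ˣ) : Matrix n n ℂ))) t :=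
    (hasDerivAt_id t).smul_const _
  have hZ2 : HasDerivAt (fun r : ℝ => r • (curlAt W X z μ ν * ((hol W z (plaqWord μ ν) : (Matrix n n ℂ)ˣ) : Matrix n n ℂ)))
      ((1 : ℝ) • (curlAt W X z μ ν * ((hol W z (plaqWord μ ν) : (Matrix n n ℂ)ˣ) : Matrix n n ℂ))) t :=
    (hasDerivAt_id t).smul_const _
  have h := (hasDerivAt_Ad_comp (W z lam) (hP.sub hP2)).sub (hZ.sub hZ2)
  simp only [one_smul] at h
  exact h

/-! ## §4 The norm of the derivative -/

/-- **THE DERIVATIVE OF THE REMAINDER PATH IS SMALL.**  `W` unitary, `X` skew, `‖X‖ ≤ α`; abstract letters on `[0,1]`: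
`Q ≥ ‖(Ad_w (d_{V_t}X)(p′) − (d_{V_t}X)(p)) − (Ad_w c′ − c)‖`, `G ≥ ‖Ad_w V_t(∂p′) − V_t(∂p)‖`, and `x₁ ≥ ‖Ad_w W(∂p′) − W(∂p)‖`.  Then for `t ∈ [0,1]`
the derivative of §3 has norm `≤ Q + 24α(e^α − 1)·G + ‖Ad_w c′ − c‖·(4α + 24α(e^α − 1)) + 4α·(G + x₁)`. [folklore] -/
theorem norm_remainderPath_deriv_le [Nonempty n] {W : Site d → Fin d → (Matrix n n ℂ)ˣ} (hW : IsUnitaryCfg W)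
    {X : Site d → Fin d → Matrix n n ℂ} (hX : IsSkewDir X) {α : ℝ} (hXα : ∀ x κ, ‖X x κ‖ ≤ α) (z : Site d) (lam μ ν : Fin d)
    {Q G x₁ : ℝ}
    (hQ : ∀ t ∈ Icc (0 : ℝ) 1, ‖(Ad (W z lam) (curlAt (vary W X t) X (z + e lam) μ ν) - curlAt (vary W X t) X z μ ν)
        - (Ad (W z lam) (curlAt W X (z + e lam) μ ν) - curlAt W X z μ ν)‖ ≤ Q)
    (hG : ∀ t ∈ Icc (0 : ℝ) 1, ‖Ad (W z lam) ((hol (vary W X t) (z + e lam) (plaqWord μ ν) : (Matrix n n ℂ)ˣ) : Matrix n n ℂ)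
        - ((hol (vary W X t) z (plaqWord μ ν) : (Matrix n n ℂ)ˣ) : Matrix n n ℂ)‖ ≤ G)
    (hx₁ : ‖Ad (W z lam) ((hol W (z + e lam) (plaqWord μ ν) : (Matrix n n ℂ)ˣ) : Matrix n n ℂ) - ((hol W z (plaqWord μ ν) : (Matrix n n ℂ)ˣ) : Matrix n n ℂ)‖ ≤ x₁)
    {t : ℝ} (ht : t ∈ Icc (0 : ℝ) 1) :
    ‖Ad (W z lam) (curlAt (vary W X t) X (z + e lam) μ ν * ((hol (vary W X t) (z + e lam) (plaqWord μ ν) : (Matrix n n ℂ)ˣ) : Matrix n n ℂ)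
            - curlAt W X (z + e lam) μ ν * ((hol W (z + e lam) (plaqWord μ ν) : (Matrix n n ℂ)ˣ) : Matrix n n ℂ))
        - (curlAt (vary W X t) X z μ ν * ((hol (vary W X t) z (plaqWord μ ν) : (Matrix n n ℂ)ˣ) : Matrix n n ℂ)
            - curlAt W X z μ ν * ((hol W z (plaqWord μ ν) : (Matrix n n ℂ)ˣ) : Matrix n n ℂ))‖
      ≤ Q + 24 * α * (Real.exp α - 1) * G
        + ‖Ad (W z lam) (curlAt W X (z + e lam) μ ν) - curlAt W X z μ ν‖ * (4 * α + 24 * α * (Real.exp α - 1)) + 4 * α * (G + x₁) := by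
  -- names
  set w : (Matrix n n ℂ)ˣ := W z lam with hw
  set fP : Matrix n n ℂ := ((hol (vary W X t) (z + e lam) (plaqWord μ ν) : (Matrix n n ℂ)ˣ) : Matrix n n ℂ) with hfP
  set fZ : Matrix n n ℂ := ((hol (vary W X t) z (plaqWord μ ν) : (Matrix n n ℂ)ˣ) : Matrix n n ℂ) with hfZ
  set B' : Matrix n n ℂ := ((hol W (z + e lam) (plaqWord μ ν) : (Matrix n n ℂ)ˣ) : Matrix n n ℂ) with hB'
  set B : Matrix n n ℂ := ((hol W z (plaqWord μ ν) : (Matrix n n ℂ)ˣ) : Matrix n n ℂ) with hB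
  set cP : Matrix n n ℂ := curlAt (vary W X t) X (z + e lam) μ ν with hcP
  set cZ : Matrix n n ℂ := curlAt (vary W X t) X z μ ν with hcZ
  set c' : Matrix n n ℂ := curlAt W X (z + e lam) μ ν with hc'
  set c : Matrix n n ℂ := curlAt W X z μ ν with hc
  have hwu : w ∈ unitaryUnits (Matrix n n ℂ) := hW z lam
  have hVu : IsUnitaryCfg (vary W X t) := vary_isUnitaryCfg hW hX t
  have hU1V : ∀ x κ, vary W X t x κ ∈ U1 (Matrix n n ℂ) := fun x κ => U1_of_unitaryUnits (hVu x κ)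
  have hfP1 : ‖fP‖ ≤ 1 := (mem_U1.mp (hol_mem hU1V (z + e lam) (plaqWord μ ν))).1
  have hα0 : 0 ≤ α := (norm_nonneg _).trans (hXα z lam)
  have hexp0 : 0 ≤ Real.exp α - 1 := by linarith [Real.add_one_le_exp α]
  have hexpt : Real.exp (t * α) - 1 ≤ Real.exp α - 1 := by
    have := Real.exp_le_exp.mpr (show t * α ≤ α by nlinarith [ht.2])
    linarith
  have hG0 : 0 ≤ G := (norm_nonneg _).trans (hG t ht)
  have hQt := hQ t ht
  have hGt := hG t ht
  -- the moving curl against the fixed one: `‖c_t − c‖ ≤ 24α(e^α − 1)`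
  have hcZc : ‖cZ - c‖ ≤ 24 * α * (Real.exp α - 1) := by
    have h := norm_curlAt_vary_sub_le hW hX hXα t X z μ ν
    rw [abs_of_nonneg ht.1] at h
    have hb := bondL1At_le_of_sup hXα z μ ν
    have hb0 := bondL1At_nonneg X z μ ν
    calc ‖cZ - c‖ ≤ 6 * (Real.exp (t * α) - 1) * bondL1At X z μ ν := h
      _ ≤ 6 * (Real.exp α - 1) * (4 * α) := mul_le_mul (mul_le_mul_of_nonneg_left hexpt (by norm_num)) hb hb0 (by positivity)
      _ = 24 * α * (Real.exp α - 1) := by ring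
  -- the moving plaquette against the fixed one: `‖V_t(∂p′) − W(∂p′)‖ ≤ 4α + 24α(e^α − 1)`
  have hfPB : ‖fP - B'‖ ≤ 4 * α + 24 * α * (Real.exp α - 1) := by
    have h := norm_hol_vary_sub_hol_le_curl hW hX hXα ht.1 (z + e lam) μ ν
    have hc4 : ‖c'‖ ≤ 4 * α := (norm_curlAt_le_bondL1At hW X _ _ _).trans (bondL1At_le_of_sup hXα _ _ _)
    have hb := bondL1At_le_of_sup hXα (z + e lam) μ ν
    have hb0 := bondL1At_nonneg X (z + e lam) μ ν
    have hin : ‖c'‖ + 6 * (Real.exp (t * α) - 1) * bondL1At X (z + e lam) μ ν ≤ 4 * α + 24 * α * (Real.exp α - 1) := by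
      have := mul_le_mul (mul_le_mul_of_nonneg_left hexpt (by norm_num : (0:ℝ) ≤ 6)) hb hb0 (by positivity)
      linarith
    have hin0 : 0 ≤ ‖c'‖ + 6 * (Real.exp (t * α) - 1) * bondL1At X (z + e lam) μ ν := by
      have : 0 ≤ Real.exp (t * α) - 1 := by linarith [Real.add_one_le_exp (t * α), mul_nonneg ht.1 hα0]
      positivity
    calc ‖fP - B'‖ ≤ t * (‖c'‖ + 6 * (Real.exp (t * α) - 1) * bondL1At X (z + e lam) μ ν) := h
      _ ≤ 1 * (4 * α + 24 * α * (Real.exp α - 1)) := mul_le_mul ht.2 hin hin0 zero_le_one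
      _ = 4 * α + 24 * α * (Real.exp α - 1) := one_mul _
  have hc4 : ‖c‖ ≤ 4 * α := (norm_curlAt_le_bondL1At hW X _ _ _).trans (bondL1At_le_of_sup hXα _ _ _)
  -- the split of the derivative
  have hsplit : Ad w (cP * fP - c' * B') - (cZ * fZ - c * B)
      = (Ad w ((cP - c') * fP) - (cZ - c) * fZ) + (Ad w (c' * (fP - B')) - c * (fZ - B)) := by
    have e1 : cP * fP - c' * B' = (cP - c') * fP + c' * (fP - B') := by noncomm_ring
    have e2 : cZ * fZ - c * B = (cZ - c) * fZ + c * (fZ - B) := by noncomm_ring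
    rw [e1, e2, Ad_add]; abel
  -- term 1
  have hT1 : ‖Ad w ((cP - c') * fP) - (cZ - c) * fZ‖ ≤ Q + 24 * α * (Real.exp α - 1) * G := by
    have h := norm_Ad_mul_sub_mul_le w (cP - c') fP (cZ - c) fZ
    have h1 : ‖Ad w (cP - c') - (cZ - c)‖ ≤ Q := by
      have e : Ad w (cP - c') - (cZ - c) = (Ad w cP - cZ) - (Ad w c' - c) := by rw [Ad_sub]; abel
      rw [e]; exact hQt
    have h2 : ‖Ad w fP‖ ≤ 1 := by rw [norm_Ad_of_unitary hwu]; exact hfP1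
    have hQ0 : 0 ≤ Q := (norm_nonneg _).trans h1
    calc _ ≤ ‖Ad w (cP - c') - (cZ - c)‖ * ‖Ad w fP‖ + ‖cZ - c‖ * ‖Ad w fP - fZ‖ := h
      _ ≤ Q * 1 + 24 * α * (Real.exp α - 1) * G :=
          add_le_add (mul_le_mul h1 h2 (norm_nonneg _) hQ0) (mul_le_mul hcZc hGt (norm_nonneg _) (by positivity))
      _ = Q + 24 * α * (Real.exp α - 1) * G := by ring
  -- term 2
  have hT2 : ‖Ad w (c' * (fP - B')) - c * (fZ - B)‖ ≤ ‖Ad w c' - c‖ * (4 * α + 24 * α * (Real.exp α - 1)) + 4 * α * (G + x₁) := by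
    have h := norm_Ad_mul_sub_mul_le w c' (fP - B') c (fZ - B)
    have h1 : ‖Ad w (fP - B')‖ ≤ 4 * α + 24 * α * (Real.exp α - 1) := by rw [norm_Ad_of_unitary hwu]; exact hfPB
    have h2 : ‖Ad w (fP - B') - (fZ - B)‖ ≤ G + x₁ := by
      have e : Ad w (fP - B') - (fZ - B) = (Ad w fP - fZ) - (Ad w B' - B) := by rw [Ad_sub]; abel
      rw [e]; exact (norm_sub_le _ _).trans (add_le_add hGt hx₁)
    calc _ ≤ ‖Ad w c' - c‖ * ‖Ad w (fP - B')‖ + ‖c‖ * ‖Ad w (fP - B') - (fZ - B)‖ := h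
      _ ≤ ‖Ad w c' - c‖ * (4 * α + 24 * α * (Real.exp α - 1)) + 4 * α * (G + x₁) :=
          add_le_add (mul_le_mul_of_nonneg_left h1 (norm_nonneg _)) (mul_le_mul hc4 h2 (norm_nonneg _) (by positivity))
  rw [hsplit]
  calc _ ≤ ‖Ad w ((cP - c') * fP) - (cZ - c) * fZ‖ + ‖Ad w (c' * (fP - B')) - c * (fZ - B)‖ := norm_add_le _ _
    _ ≤ (Q + 24 * α * (Real.exp α - 1) * G) + (‖Ad w c' - c‖ * (4 * α + 24 * α * (Real.exp α - 1)) + 4 * α * (G + x₁)) := add_le_add hT1 hT2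
    _ = _ := by ring

/-! ## §5 The remainder is Lipschitz; the raw absorbed reading -/

/-- **THE SECOND-ORDER REMAINDER OF THE REVERSE CURL READING IS LIPSCHITZ** (mean value on `[0,1]` for the path of §3): with
`E₂(p) = U′(∂p) − W(∂p) − (d_W X)(p)·W(∂p)` (`U′ = W e^{X}`) and the letters of §4,
`‖Ad_{W(z,λ)} E₂(p′) − E₂(p)‖ ≤ Q + 24α(e^α − 1)·G + ‖Ad_w c′ − c‖·(4α + 24α(e^α − 1)) + 4α·(G + x₁)`. [folklore] -/
theorem norm_remainder_covDiff_le [Nonempty n] {W : Site d → Fin d → (Matrix n n ℂ)ˣ} (hW : IsUnitaryCfg W)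
    {X : Site d → Fin d → Matrix n n ℂ} (hX : IsSkewDir X) {α : ℝ} (hXα : ∀ x κ, ‖X x κ‖ ≤ α) (z : Site d) (lam μ ν : Fin d)
    {Q G x₁ : ℝ}
    (hQ : ∀ t ∈ Icc (0 : ℝ) 1, ‖(Ad (W z lam) (curlAt (vary W X t) X (z + e lam) μ ν) - curlAt (vary W X t) X z μ ν)
        - (Ad (W z lam) (curlAt W X (z + e lam) μ ν) - curlAt W X z μ ν)‖ ≤ Q)
    (hG : ∀ t ∈ Icc (0 : ℝ) 1, ‖Ad (W z lam) ((hol (vary W X t) (z + e lam) (plaqWord μ ν) : (Matrix n n ℂ)ˣ) : Matrix n n ℂ)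
        - ((hol (vary W X t) z (plaqWord μ ν) : (Matrix n n ℂ)ˣ) : Matrix n n ℂ)‖ ≤ G)
    (hx₁ : ‖Ad (W z lam) ((hol W (z + e lam) (plaqWord μ ν) : (Matrix n n ℂ)ˣ) : Matrix n n ℂ) - ((hol W z (plaqWord μ ν) : (Matrix n n ℂ)ˣ) : Matrix n n ℂ)‖ ≤ x₁) :
    ‖Ad (W z lam) (((hol (vary W X 1) (z + e lam) (plaqWord μ ν) : (Matrix n n ℂ)ˣ) : Matrix n n ℂ)
            - ((hol W (z + e lam) (plaqWord μ ν) : (Matrix n n ℂ)ˣ) : Matrix n n ℂ)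
            - curlAt W X (z + e lam) μ ν * ((hol W (z + e lam) (plaqWord μ ν) : (Matrix n n ℂ)ˣ) : Matrix n n ℂ))
        - (((hol (vary W X 1) z (plaqWord μ ν) : (Matrix n n ℂ)ˣ) : Matrix n n ℂ) - ((hol W z (plaqWord μ ν) : (Matrix n n ℂ)ˣ) : Matrix n n ℂ)
            - curlAt W X z μ ν * ((hol W z (plaqWord μ ν) : (Matrix n n ℂ)ˣ) : Matrix n n ℂ))‖
      ≤ Q + 24 * α * (Real.exp α - 1) * G
        + ‖Ad (W z lam) (curlAt W X (z + e lam) μ ν) - curlAt W X z μ ν‖ * (4 * α + 24 * α * (Real.exp α - 1)) + 4 * α * (G + x₁) := by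
  set w : (Matrix n n ℂ)ˣ := W z lam with hw
  set c'B' : Matrix n n ℂ := curlAt W X (z + e lam) μ ν * ((hol W (z + e lam) (plaqWord μ ν) : (Matrix n n ℂ)ˣ) : Matrix n n ℂ) with hc'B'
  set cB : Matrix n n ℂ := curlAt W X z μ ν * ((hol W z (plaqWord μ ν) : (Matrix n n ℂ)ˣ) : Matrix n n ℂ) with hcB
  set A'm : Matrix n n ℂ := ((hol (vary W X 1) (z + e lam) (plaqWord μ ν) : (Matrix n n ℂ)ˣ) : Matrix n n ℂ) with hA'm
  set Am : Matrix n n ℂ := ((hol (vary W X 1) z (plaqWord μ ν) : (Matrix n n ℂ)ˣ) : Matrix n n ℂ) with hAm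
  set B'm : Matrix n n ℂ := ((hol W (z + e lam) (plaqWord μ ν) : (Matrix n n ℂ)ˣ) : Matrix n n ℂ) with hB'm
  set Bm : Matrix n n ℂ := ((hol W z (plaqWord μ ν) : (Matrix n n ℂ)ˣ) : Matrix n n ℂ) with hBm
  set F : ℝ → Matrix n n ℂ := fun r =>
      Ad w (((hol (vary W X r) (z + e lam) (plaqWord μ ν) : (Matrix n n ℂ)ˣ) : Matrix n n ℂ) - r • c'B')
        - (((hol (vary W X r) z (plaqWord μ ν) : (Matrix n n ℂ)ˣ) : Matrix n n ℂ) - r • cB) with hF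
  set F' : ℝ → Matrix n n ℂ := fun t =>
      Ad w (curlAt (vary W X t) X (z + e lam) μ ν * ((hol (vary W X t) (z + e lam) (plaqWord μ ν) : (Matrix n n ℂ)ˣ) : Matrix n n ℂ) - c'B')
        - (curlAt (vary W X t) X z μ ν * ((hol (vary W X t) z (plaqWord μ ν) : (Matrix n n ℂ)ˣ) : Matrix n n ℂ) - cB) with hF'
  set R : ℝ := Q + 24 * α * (Real.exp α - 1) * G
        + ‖Ad w (curlAt W X (z + e lam) μ ν) - curlAt W X z μ ν‖ * (4 * α + 24 * α * (Real.exp α - 1)) + 4 * α * (G + x₁) with hR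
  have hderiv : ∀ t ∈ Icc (0 : ℝ) 1, HasDerivWithinAt F (F' t) (Icc (0 : ℝ) 1) t :=
    fun t _ => (hasDerivAt_remainderPath W X z lam μ ν t).hasDerivWithinAt
  have hbound : ∀ t ∈ Ico (0 : ℝ) 1, ‖F' t‖ ≤ R :=
    fun t ht => norm_remainderPath_deriv_le hW hX hXα z lam μ ν hQ hG hx₁ ⟨ht.1, ht.2.le⟩
  have hmv := norm_image_sub_le_of_norm_deriv_le_segment' hderiv hbound 1 (right_mem_Icc.mpr zero_le_one)
  rw [sub_zero, mul_one] at hmv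
  -- the endpoint values of the path
  have eF1 : F 1 = Ad w (A'm - c'B') - (Am - cB) := by
    show Ad w (A'm - (1 : ℝ) • c'B') - (Am - (1 : ℝ) • cB) = _
    rw [one_smul, one_smul]
  have eF0 : F 0 = Ad w B'm - Bm := by
    show Ad w (((hol (vary W X 0) (z + e lam) (plaqWord μ ν) : (Matrix n n ℂ)ˣ) : Matrix n n ℂ) - (0 : ℝ) • c'B')
        - (((hol (vary W X 0) z (plaqWord μ ν) : (Matrix n n ℂ)ˣ) : Matrix n n ℂ) - (0 : ℝ) • cB) = _
    rw [vary_zero, zero_smul, zero_smul, sub_zero, sub_zero]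
  rw [eF1, eF0] at hmv
  have e2 : Ad w (A'm - c'B') - (Am - cB) - (Ad w B'm - Bm) = Ad w (A'm - B'm - c'B') - (Am - Bm - cB) := by
    rw [Ad_sub, Ad_sub, Ad_sub]; abel
  rw [e2] at hmv
  exact hmv

/-- `‖Ad_w W(∂p′)⁻¹ − W(∂p)⁻¹‖ ≤ ‖Ad_w W(∂p′) − W(∂p)‖` for a unitary configuration (gen 106's `Ad_inv_sub_inv_eq`). [folklore] -/
theorem norm_Ad_inv_sub_inv_le [Nonempty n] {W : Site d → Fin d → (Matrix n n ℂ)ˣ} (hW : IsUnitaryCfg W) (z : Site d) (lam μ ν : Fin d) :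
    ‖Ad (W z lam) (((hol W (z + e lam) (plaqWord μ ν))⁻¹ : (Matrix n n ℂ)ˣ) : Matrix n n ℂ) - (((hol W z (plaqWord μ ν))⁻¹ : (Matrix n n ℂ)ˣ) : Matrix n n ℂ)‖
      ≤ ‖Ad (W z lam) ((hol W (z + e lam) (plaqWord μ ν) : (Matrix n n ℂ)ˣ) : Matrix n n ℂ) - ((hol W z (plaqWord μ ν) : (Matrix n n ℂ)ˣ) : Matrix n n ℂ)‖ := by
  set w : (Matrix n n ℂ)ˣ := W z lam
  set B' : (Matrix n n ℂ)ˣ := hol W (z + e lam) (plaqWord μ ν)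
  set B : (Matrix n n ℂ)ˣ := hol W z (plaqWord μ ν)
  have hwu : w ∈ unitaryUnits (Matrix n n ℂ) := hW z lam
  have hU1W : ∀ x κ, W x κ ∈ U1 (Matrix n n ℂ) := fun x κ => U1_of_unitaryUnits (hW x κ)
  have hBi1 : ‖((B⁻¹ : (Matrix n n ℂ)ˣ) : Matrix n n ℂ)‖ ≤ 1 := (mem_U1.mp (hol_mem hU1W z (plaqWord μ ν))).2
  have hB'i1 : ‖((B'⁻¹ : (Matrix n n ℂ)ˣ) : Matrix n n ℂ)‖ ≤ 1 := (mem_U1.mp (hol_mem hU1W (z + e lam) (plaqWord μ ν))).2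
  rw [Ad_inv_sub_inv_eq]
  have h1 : ‖Ad w ((B'⁻¹ : (Matrix n n ℂ)ˣ) : Matrix n n ℂ)‖ ≤ 1 := by rw [norm_Ad_of_unitary hwu]; exact hB'i1
  calc _ ≤ ‖Ad w ((B'⁻¹ : (Matrix n n ℂ)ˣ) : Matrix n n ℂ) * ((B : Matrix n n ℂ) - Ad w (B' : Matrix n n ℂ))‖ * ‖((B⁻¹ : (Matrix n n ℂ)ˣ) : Matrix n n ℂ)‖ :=
        norm_mul_le _ _
    _ ≤ (‖Ad w ((B'⁻¹ : (Matrix n n ℂ)ˣ) : Matrix n n ℂ)‖ * ‖(B : Matrix n n ℂ) - Ad w (B' : Matrix n n ℂ)‖) * 1 :=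
        mul_le_mul (norm_mul_le _ _) hBi1 (norm_nonneg _) (by positivity)
    _ ≤ (1 * ‖(B : Matrix n n ℂ) - Ad w (B' : Matrix n n ℂ)‖) * 1 := by gcongr
    _ = ‖Ad w (B' : Matrix n n ℂ) - (B : Matrix n n ℂ)‖ := by rw [one_mul, mul_one, norm_sub_rev]

/-- **THE SIZE OF THE REMAINDER**: `‖E₂(p)‖ ≤ 8α + 24α(e^α − 1)` (`‖U′(∂p) − W(∂p)‖ ≤ ‖c‖ + 24α(e^α − 1)` by `norm_hol_vary_sub_hol_le_curl`, `‖c‖ ≤ 4α`). [folklore] -/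
theorem norm_remainder_le [Nonempty n] {W : Site d → Fin d → (Matrix n n ℂ)ˣ} (hW : IsUnitaryCfg W)
    {X : Site d → Fin d → Matrix n n ℂ} (hX : IsSkewDir X) {α : ℝ} (hXα : ∀ x κ, ‖X x κ‖ ≤ α) (z : Site d) (μ ν : Fin d) :
    ‖((hol (vary W X 1) z (plaqWord μ ν) : (Matrix n n ℂ)ˣ) : Matrix n n ℂ) - ((hol W z (plaqWord μ ν) : (Matrix n n ℂ)ˣ) : Matrix n n ℂ)
        - curlAt W X z μ ν * ((hol W z (plaqWord μ ν) : (Matrix n n ℂ)ˣ) : Matrix n n ℂ)‖ ≤ 8 * α + 24 * α * (Real.exp α - 1) := by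
  have hα0 : 0 ≤ α := (norm_nonneg _).trans (hXα z μ)
  have hU1W : ∀ x κ, W x κ ∈ U1 (Matrix n n ℂ) := fun x κ => U1_of_unitaryUnits (hW x κ)
  have hB1 : ‖((hol W z (plaqWord μ ν) : (Matrix n n ℂ)ˣ) : Matrix n n ℂ)‖ ≤ 1 := (mem_U1.mp (hol_mem hU1W z (plaqWord μ ν))).1
  have hc4 : ‖curlAt W X z μ ν‖ ≤ 4 * α := (norm_curlAt_le_bondL1At hW X _ _ _).trans (bondL1At_le_of_sup hXα _ _ _)
  have h := norm_hol_vary_sub_hol_le_curl hW hX hXα zero_le_one z μ ν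
  rw [one_mul, one_mul] at h
  have hb := bondL1At_le_of_sup hXα z μ ν
  have hb0 := bondL1At_nonneg X z μ ν
  have hexp0 : 0 ≤ Real.exp α - 1 := by linarith [Real.add_one_le_exp α]
  have hAB : ‖((hol (vary W X 1) z (plaqWord μ ν) : (Matrix n n ℂ)ˣ) : Matrix n n ℂ) - ((hol W z (plaqWord μ ν) : (Matrix n n ℂ)ˣ) : Matrix n n ℂ)‖
      ≤ 4 * α + 24 * α * (Real.exp α - 1) := by
    have := mul_le_mul_of_nonneg_left hb (show (0:ℝ) ≤ 6 * (Real.exp α - 1) by positivity)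
    linarith
  calc _ ≤ ‖((hol (vary W X 1) z (plaqWord μ ν) : (Matrix n n ℂ)ˣ) : Matrix n n ℂ) - ((hol W z (plaqWord μ ν) : (Matrix n n ℂ)ˣ) : Matrix n n ℂ)‖
          + ‖curlAt W X z μ ν * ((hol W z (plaqWord μ ν) : (Matrix n n ℂ)ˣ) : Matrix n n ℂ)‖ := norm_sub_le _ _
    _ ≤ (4 * α + 24 * α * (Real.exp α - 1)) + 4 * α * 1 :=
        add_le_add hAB ((norm_mul_le _ _).trans (mul_le_mul hc4 hB1 (norm_nonneg _) (by positivity)))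
    _ = 8 * α + 24 * α * (Real.exp α - 1) := by ring

/-- **THE RAW ABSORBED READING OF THE CURL'S GRADIENT** (abstract letters `Q, G, x₁` as in §4): with `D(p) = U′(∂p)·W(∂p)⁻¹ − 1` ((S-b)₁'s quotient),
`‖Ad_w (d_W X)(p′) − (d_W X)(p)‖ ≤ ‖Ad_w D(p′) − D(p)‖ + (Q + 24α(e^α − 1)G + ‖Ad_w (d_W X)(p′) − (d_W X)(p)‖·(4α + 24α(e^α − 1)) + 4α(G + x₁))
 + (8α + 24α(e^α − 1))·x₁` (`c = D − E₂·W(∂p)⁻¹`, product rule, §5). [folklore] -/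
theorem norm_curl_covDiff_le_abstract [Nonempty n] {W : Site d → Fin d → (Matrix n n ℂ)ˣ} (hW : IsUnitaryCfg W)
    {X : Site d → Fin d → Matrix n n ℂ} (hX : IsSkewDir X) {α : ℝ} (hXα : ∀ x κ, ‖X x κ‖ ≤ α) (z : Site d) (lam μ ν : Fin d)
    {Q G x₁ : ℝ}
    (hQ : ∀ t ∈ Icc (0 : ℝ) 1, ‖(Ad (W z lam) (curlAt (vary W X t) X (z + e lam) μ ν) - curlAt (vary W X t) X z μ ν)
        - (Ad (W z lam) (curlAt W X (z + e lam) μ ν) - curlAt W X z μ ν)‖ ≤ Q)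
    (hG : ∀ t ∈ Icc (0 : ℝ) 1, ‖Ad (W z lam) ((hol (vary W X t) (z + e lam) (plaqWord μ ν) : (Matrix n n ℂ)ˣ) : Matrix n n ℂ)
        - ((hol (vary W X t) z (plaqWord μ ν) : (Matrix n n ℂ)ˣ) : Matrix n n ℂ)‖ ≤ G)
    (hx₁ : ‖Ad (W z lam) ((hol W (z + e lam) (plaqWord μ ν) : (Matrix n n ℂ)ˣ) : Matrix n n ℂ) - ((hol W z (plaqWord μ ν) : (Matrix n n ℂ)ˣ) : Matrix n n ℂ)‖ ≤ x₁) :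
    ‖Ad (W z lam) (curlAt W X (z + e lam) μ ν) - curlAt W X z μ ν‖
      ≤ ‖Ad (W z lam) (((hol (vary W X 1) (z + e lam) (plaqWord μ ν) * (hol W (z + e lam) (plaqWord μ ν))⁻¹ : (Matrix n n ℂ)ˣ) : Matrix n n ℂ) - 1)
            - ((((hol (vary W X 1) z (plaqWord μ ν) * (hol W z (plaqWord μ ν))⁻¹ : (Matrix n n ℂ)ˣ) : Matrix n n ℂ)) - 1)‖
        + (Q + 24 * α * (Real.exp α - 1) * G
            + ‖Ad (W z lam) (curlAt W X (z + e lam) μ ν) - curlAt W X z μ ν‖ * (4 * α + 24 * α * (Real.exp α - 1)) + 4 * α * (G + x₁))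
        + (8 * α + 24 * α * (Real.exp α - 1)) * x₁ := by
  -- names
  set w : (Matrix n n ℂ)ˣ := W z lam with hw
  set A' : (Matrix n n ℂ)ˣ := hol (vary W X 1) (z + e lam) (plaqWord μ ν) with hA'
  set A : (Matrix n n ℂ)ˣ := hol (vary W X 1) z (plaqWord μ ν) with hA
  set B' : (Matrix n n ℂ)ˣ := hol W (z + e lam) (plaqWord μ ν) with hB'
  set B : (Matrix n n ℂ)ˣ := hol W z (plaqWord μ ν) with hB
  set c' : Matrix n n ℂ := curlAt W X (z + e lam) μ ν with hc'
  set c : Matrix n n ℂ := curlAt W X z μ ν with hc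
  set E' : Matrix n n ℂ := (A' : Matrix n n ℂ) - (B' : Matrix n n ℂ) - c' * (B' : Matrix n n ℂ) with hE'
  set E : Matrix n n ℂ := (A : Matrix n n ℂ) - (B : Matrix n n ℂ) - c * (B : Matrix n n ℂ) with hE
  have hwu : w ∈ unitaryUnits (Matrix n n ℂ) := hW z lam
  have hU1W : ∀ x κ, W x κ ∈ U1 (Matrix n n ℂ) := fun x κ => U1_of_unitaryUnits (hW x κ)
  have hB'i1 : ‖((B'⁻¹ : (Matrix n n ℂ)ˣ) : Matrix n n ℂ)‖ ≤ 1 := (mem_U1.mp (hol_mem hU1W (z + e lam) (plaqWord μ ν))).2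
  -- `c = (A·B⁻¹ − 1) − E·B⁻¹`
  have hcE : c = (((A * B⁻¹ : (Matrix n n ℂ)ˣ) : Matrix n n ℂ) - 1) - E * ((B⁻¹ : (Matrix n n ℂ)ˣ) : Matrix n n ℂ) := by
    rw [hE, Units.val_mul, sub_mul, sub_mul, mul_assoc c, Units.mul_inv, mul_one]
    abel
  have hcE' : c' = (((A' * B'⁻¹ : (Matrix n n ℂ)ˣ) : Matrix n n ℂ) - 1) - E' * ((B'⁻¹ : (Matrix n n ℂ)ˣ) : Matrix n n ℂ) := by
    rw [hE', Units.val_mul, sub_mul, sub_mul, mul_assoc c', Units.mul_inv, mul_one]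
    abel
  have hsplit : Ad w c' - c = (Ad w (((A' * B'⁻¹ : (Matrix n n ℂ)ˣ) : Matrix n n ℂ) - 1) - (((A * B⁻¹ : (Matrix n n ℂ)ˣ) : Matrix n n ℂ) - 1))
      - (Ad w (E' * ((B'⁻¹ : (Matrix n n ℂ)ˣ) : Matrix n n ℂ)) - E * ((B⁻¹ : (Matrix n n ℂ)ˣ) : Matrix n n ℂ)) := by
    rw [hcE, hcE', Ad_sub]; abel
  -- the remainder terms
  have hR := norm_remainder_covDiff_le hW hX hXα z lam μ ν hQ hG hx₁
  have hE2 := norm_remainder_le hW hX hXα z μ ν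
  have hinv := norm_Ad_inv_sub_inv_le hW z lam μ ν
  have hx₁0 : 0 ≤ x₁ := (norm_nonneg _).trans hx₁
  have hprod := norm_Ad_mul_sub_mul_le w E' ((B'⁻¹ : (Matrix n n ℂ)ˣ) : Matrix n n ℂ) E ((B⁻¹ : (Matrix n n ℂ)ˣ) : Matrix n n ℂ)
  have h1 : ‖Ad w ((B'⁻¹ : (Matrix n n ℂ)ˣ) : Matrix n n ℂ)‖ ≤ 1 := by rw [norm_Ad_of_unitary hwu]; exact hB'i1
  have hT : ‖Ad w (E' * ((B'⁻¹ : (Matrix n n ℂ)ˣ) : Matrix n n ℂ)) - E * ((B⁻¹ : (Matrix n n ℂ)ˣ) : Matrix n n ℂ)‖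
      ≤ (Q + 24 * α * (Real.exp α - 1) * G + ‖Ad w c' - c‖ * (4 * α + 24 * α * (Real.exp α - 1)) + 4 * α * (G + x₁)) * 1
        + (8 * α + 24 * α * (Real.exp α - 1)) * x₁ := by
    refine hprod.trans (add_le_add (mul_le_mul hR h1 (norm_nonneg _) ((norm_nonneg _).trans hR)) ?_)
    exact mul_le_mul hE2 (hinv.trans hx₁) (norm_nonneg _) ((norm_nonneg _).trans hE2)
  rw [mul_one] at hT
  have hmain : ‖Ad w c' - c‖ ≤ ‖Ad w (((A' * B'⁻¹ : (Matrix n n ℂ)ˣ) : Matrix n n ℂ) - 1) - (((A * B⁻¹ : (Matrix n n ℂ)ˣ) : Matrix n n ℂ) - 1)‖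
      + ‖Ad w (E' * ((B'⁻¹ : (Matrix n n ℂ)ˣ) : Matrix n n ℂ)) - E * ((B⁻¹ : (Matrix n n ℂ)ˣ) : Matrix n n ℂ)‖ := by
    conv_lhs => rw [hsplit]
    exact norm_sub_le _ _
  linarith

end

end Summit.QuantumFields.BalabanUV.T4Continuum.NE7CurlRemainderGradient
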